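import Literature.Analysis.FluidPDE.ClassicalSobolevUniqueness
import Literature.Analysis.FluidPDE.NSVorticityBKMProofs
import Literature.Analysis.FluidPDE.NSVorticityBKMLocalExistence
import Literature.Analysis.FluidPDE.NSVorticityBKMContinuation
import HarnessLib

/-!
# The Beale–Kato–Majda criterion (**ns.S09**) and its blow-up form, discharged

Analysis/FluidPDE proof file (theorems only, no definitions, no named facts). The two named facts
of `NSVorticity.lean`

* `Literature.Analysis.FluidPDE.beale_kato_majda` (**ns.S09**; Beale–Kato–Majda 1984, Thm. 1 and
  Corollary; Majda–Bertozzi 2002, Thm. 3.6: for `ν ≥ 0` and a classical unforced solution on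
  `ℝ³ × [0, T)` in the class `⋂ₛ C([0, T'']; H^s)`, continuation in the class past `T` iff
  `∫₀ᵀ ‖curl u(t)‖_{L^∞} dt < ∞`), and
* `Literature.Analysis.FluidPDE.lintegral_iSup_curl_eq_top_of_not_hasSobolevExtensionPast` (its
  blow-up form, Beale–Kato–Majda 1984, Thm. 1 as printed: if the solution cannot be continued in
  the class to `T`, then `∫₀ᵀ ‖ω(t)‖_{L^∞} dt = ∞`)

are now theorems: `beale_kato_majda_holds`,
`lintegral_iSup_curl_eq_top_of_not_hasSobolevExtensionPast_holds`.

## The proof (assembly of theorems of the tree)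

`NSVorticityBKM.lean` reduced both facts to the three printed ingredients of Majda–Bertozzi's
proof of Thm. 3.6 (`beale_kato_majda_of_parts`,
`lintegral_iSup_curl_eq_top_of_not_hasSobolevExtensionPast_of_parts`: direction (⇒) unconditional,
direction (⇐) by restart-and-glue), each of which has since been proved in the tree:

1. local existence in `H^m` with `H³`-controlled lifespan, Thm. 3.4 (i)–(ii) with (3.79) —
   `MajdaBertozzi2002_localExistenceH3_holds` (`NSVorticityBKMLocalExistence.lean`: Fourier–Galerkin
   for `ν = 0`, the Fourier-side Picard theorem for `ν > 0`);
2. uniqueness in the class, Cor. 3.1 — `MajdaBertozzi2002_uniquenessSobolev_holds`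
   (`ClassicalSobolevUniqueness.lean`: vorticity energy method without dissipation), already
   threaded into `beale_kato_majda_of_localExistence_of_apriori`;
3. the a priori `H³` bound under `∫‖ω‖_∞ < ∞`, (3.79)–(3.83) with Prop. 3.8 —
   `MajdaBertozzi2002_bkmAprioriH3_holds` (`NSVorticityBKMProofs.lean`).

Also recorded, now unconditionally: the continuation principle in the BKM class
(Majda–Bertozzi 2002, Cor. 3.2, p. 112: continuation past `T` iff `sup_{t<T} ‖v(t)‖₃ < ∞`),
`hasSobolevExtensionPast_iff_exists_H3_bound`, from
`hasSobolevExtensionPast_iff_exists_H3_bound_of_parts` (`NSVorticityBKMContinuation.lean`).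

## Why a sibling file

`NSVorticityBKMProofs`, `NSVorticityBKMLocalExistence` and `ClassicalSobolevUniqueness` all import
`NSVorticityBKM`, which imports `NSVorticity`; the discharges therefore cannot be appended to
either statement file without closing an import cycle.

## Mathlib / tree search

Tree (all used, `lean search '_holds'`): `beale_kato_majda_of_localExistence_of_apriori`
(`ClassicalSobolevUniqueness`), `lintegral_iSup_curl_eq_top_of_not_hasSobolevExtensionPast_of_bkm`
(`NSVorticityBKM`), `MajdaBertozzi2002_localExistenceH3_holds` (`NSVorticityBKMLocalExistence`),
`MajdaBertozzi2002_bkmAprioriH3_holds` (`NSVorticityBKMProofs`),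
`MajdaBertozzi2002_uniquenessSobolev_holds` (`ClassicalSobolevUniqueness`),
`hasSobolevExtensionPast_iff_exists_H3_bound_of_parts` (`NSVorticityBKMContinuation`). No
`beale_kato_majda_holds` / `…_not_hasSobolevExtensionPast_holds` existed before this file.
Mathlib has no Euler/Navier–Stokes theory.

## References

* J. T. Beale, T. Kato, A. Majda, *Remarks on the breakdown of smooth solutions for the 3-D
  Euler equations*, Comm. Math. Phys. 94 (1984), 61–66: Theorem 1 and Corollary, §1.
  [BealeKatoMajda1984]
* A. J. Majda, A. L. Bertozzi, *Vorticity and Incompressible Flow*, CUP 2002: Thm. 3.6 (p. 115)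
  and its proof (pp. 116–117), Thm. 3.4 (p. 104), Cor. 3.1 (p. 88), Cor. 3.2 (p. 112).
  [MajdaBertozzi2002]
-/

noncomputable section

open MeasureTheory Set Function Filter
open scoped ENNReal NNReal

namespace Literature.Analysis.FluidPDE

/-- **ns.S09, the Beale–Kato–Majda criterion, discharged** (Beale–Kato–Majda 1984, Thm. 1 and
Corollary; Majda–Bertozzi 2002, Thm. 3.6, `ν ≥ 0`, Euler included): the assembly
`beale_kato_majda_of_localExistence_of_apriori` fed with the discharged local existence theorem
(`MajdaBertozzi2002_localExistenceH3_holds`) and the discharged a priori `H³` bound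
(`MajdaBertozzi2002_bkmAprioriH3_holds`); uniqueness (`MajdaBertozzi2002_uniquenessSobolev_holds`)
is already inside the assembly. [cite: MajdaBertozzi2002, Thm. 3.6 (p. 115) and its proof (pp. 116-117)] -/
theorem beale_kato_majda_holds : beale_kato_majda :=
  beale_kato_majda_of_localExistence_of_apriori MajdaBertozzi2002_localExistenceH3_holds
    MajdaBertozzi2002_bkmAprioriH3_holds

/-- **Beale–Kato–Majda 1984, Theorem 1 as printed (blow-up form of ns.S09), discharged**: "suppose
there is a time `T` such that the solution cannot be continued in the class to `T`; then
`∫₀ᵀ |ω(t)|_{L^∞} dt = ∞`", for `ν ≥ 0` — the formal consequence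
`lintegral_iSup_curl_eq_top_of_not_hasSobolevExtensionPast_of_bkm` of `beale_kato_majda_holds`
(this is the interim proof preserved under the fact in `NSVorticity.lean`). [cite: BealeKatoMajda1984, Theorem 1] -/
theorem lintegral_iSup_curl_eq_top_of_not_hasSobolevExtensionPast_holds :
    lintegral_iSup_curl_eq_top_of_not_hasSobolevExtensionPast :=
  lintegral_iSup_curl_eq_top_of_not_hasSobolevExtensionPast_of_bkm beale_kato_majda_holds

/-- **The continuation principle in the BKM class, unconditionally** (Majda–Bertozzi 2002,
Cor. 3.2, p. 112, with Cor. 3.1: a classical unforced solution on `[0, T)`, `ν ≥ 0`, with all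
`L²` Sobolev norms bounded on every `[0, T'']`, `T'' < T`, continues in the class past `T` iff
`Σ_{n ≤ 3} ∫‖Dⁿu(t)‖²` is bounded on `[0, T)`): `hasSobolevExtensionPast_iff_exists_H3_bound_of_parts`
fed with the discharged local existence and uniqueness theorems. [cite: MajdaBertozzi2002, Cor. 3.2 (p. 112) with Thm. 3.4 and Cor. 3.1] -/
theorem hasSobolevExtensionPast_iff_exists_H3_bound {ν : ℝ} (hν : 0 ≤ ν) {T : ℝ} (hT : 0 < T)
    {u : ℝ → EuclideanSpace ℝ (Fin 3) → EuclideanSpace ℝ (Fin 3)}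
    {p : ℝ → EuclideanSpace ℝ (Fin 3) → ℝ}
    (hsol : IsClassicalNSSolutionOn (Ico 0 T) ν 0 u p)
    (hreg : ∀ T'' < T, HasBoundedSobolevNormsOn (Icc 0 T'') u) :
    HasSobolevExtensionPast ν u T ↔
      ∃ A : ℝ≥0, ∀ t ∈ Ico 0 T,
        (∑ n ∈ Finset.range 4, ∫⁻ x, ‖iteratedFDeriv ℝ n (u t) x‖ₑ ^ 2) ≤ A :=
  hasSobolevExtensionPast_iff_exists_H3_bound_of_parts MajdaBertozzi2002_localExistenceH3_holds
    MajdaBertozzi2002_uniquenessSobolev_holds hν hT hsol hreg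

end Literature.Analysis.FluidPDE

end
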